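import Mathlib.LinearAlgebra.Matrix.NonsingularInverse
import Summits.ResolutionOfSingularities.ResolutionOfSingularities.Theorems.PurelyInseparableDim4ApproxCoordChange
import HarnessLib
import HarnessLib.Audit.Tags

/-!
# Purely inseparable four-folds — the jet inverse function theorem: an origin-fixing substitution with
# invertible tangent map is invertible modulo every power of `𝔪₀` (cell `res-dim4-pi`, K2(p) lane, brick
# «swap normalisation», FILE J1)

[OURS · counted 0 · cell `res-dim4-pi` · seat res-dim4-p-11 g3 · the statement is res-dim4-p-7 g3's J1 (bus
2026-08-29T01:52:59Z), verbatim; desk WORD #122.]  Nothing here proves K2(p), `NoIsolatedTrap p p`, or resolution of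
singularities in dimension ≥ 4 / characteristic `p`.  AI kernel work, weaker than expert review.

For `g = (g₁,…,g₄)`, `gᵢ ∈ K[x₁,…,x₄]` with `gᵢ(0) = 0` and `det (∂gᵢ/∂x_k (0))` a unit, and every `M`, there is an
origin-fixing `g'` with `g'(g(x)) ≡ x ≡ g(g'(x)) mod 𝔪₀ᴹ` (`exists_approx_inverse`) — exactly the hypotheses
`hg, hg', hgg', hg'g` of `ApproxCoordChange.isIsolated_aeval` / `isCert_aeval` / `ordZero_aeval` (p-7 g3's SN2).

Proof.  §1 one estimate drives everything: for origin-fixing `θ₁ ≡ θ₂ mod 𝔪₀ⁿ` and `r ∈ 𝔪₀^{D+1}`,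
`r(θ₁) − r(θ₂) ∈ 𝔪₀^{n+D}` (`aeval_sub_aeval_mem_pow`, induction on `D` through `𝔪₀^{D+2} = 𝔪₀·𝔪₀^{D+1}`).
§2 for `w` with tangent map the identity (`wᵢ − xᵢ ∈ 𝔪₀²`) the contractions `k ↦ k − (k∘w − x)` and
`q ↦ q − (w∘q − x)` gain one order per step (left / right inverses), and a left inverse is congruent to a right
inverse (`g″ ≡ g″∘g∘g′ ≡ g′`), hence two-sided (`exists_inv_of_tangent_id`).  §3 the general case reduces to §2 by the
linear substitution `x ↦ L⁻¹x`, `L` the tangent matrix (`Matrix.nonsing_inv`).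
[folklore: formal inverse function theorem, truncated; cf. Bourbaki, Algèbre IV §4 no. 7] bears_on:
LADDER-RESOLUTION:D157-DOOR2 (res-dim4-pi · K2(p) · swap normalisation J1).  Supports
stmt-ResolutionOfSingularities-16155 (helper).
-/

set_option linter.dupNamespace false -- mandated namespace of this single-conjunct summit

noncomputable section

namespace Summit.ResolutionOfSingularities.ResolutionOfSingularities.Theorems.PIDim4

namespace JetInverse

open MvPolynomial Finset
open Literature.AlgebraicGeometry.Resolution
open Literature.AlgebraicGeometry.Resolution.Hauser2010

variable {K : Type} [Field K]

/-! ## §1 The basic estimate -/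

/-- An origin-fixing substitution maps `𝔪₀ⁿ` into `𝔪₀ⁿ` (element form). [folklore] -/
theorem aeval_mem_pow {θ : Fin 4 → MvPolynomial (Fin 4) K} (hθ : ∀ i, constantCoeff (θ i) = 0) {n : ℕ}
    {r : MvPolynomial (Fin 4) K} (hr : r ∈ originIdeal K ^ n) : aeval θ r ∈ originIdeal K ^ n :=
  ApproxCoordChange.map_pow_le hθ n (Ideal.mem_map_of_mem _ hr)

/-- **The basic estimate.**  For origin-fixing substitutions `θ₁ ≡ θ₂ mod 𝔪₀ⁿ` (letterwise) and `r ∈ 𝔪₀^{D+1}`: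
`r(θ₁) − r(θ₂) ∈ 𝔪₀^{n+D}` — a product of `D + 1` factors from `𝔪₀` changes, when one factor moves by `𝔪₀ⁿ`,
by `𝔪₀ⁿ·𝔪₀^{D}`. [folklore] -/
theorem aeval_sub_aeval_mem_pow {θ₁ θ₂ : Fin 4 → MvPolynomial (Fin 4) K}
    (hθ₁ : ∀ i, constantCoeff (θ₁ i) = 0) (hθ₂ : ∀ i, constantCoeff (θ₂ i) = 0) {n : ℕ}
    (h : ∀ i, θ₁ i - θ₂ i ∈ originIdeal K ^ n) {D : ℕ} {r : MvPolynomial (Fin 4) K}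
    (hr : r ∈ originIdeal K ^ (D + 1)) : aeval θ₁ r - aeval θ₂ r ∈ originIdeal K ^ (n + D) := by
  induction D generalizing r with
  | zero => rw [add_zero]; exact ApproxCoordChange.aeval_sub_aeval_mem h r
  | succ D ih =>
    rw [pow_succ'] at hr
    refine Submodule.mul_induction_on hr (fun a ha b hb => ?_) (fun x y hx hy => ?_)
    · have ha1 : aeval θ₁ a ∈ originIdeal K ^ 1 := aeval_mem_pow hθ₁ (by rwa [pow_one])
      have h1 : aeval θ₁ a * (aeval θ₁ b - aeval θ₂ b) ∈ originIdeal K ^ (n + (D + 1)) := by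
        have := Ideal.mul_mem_mul ha1 (ih hb)
        rwa [← pow_add, show 1 + (n + D) = n + (D + 1) by ring] at this
      have h2 : (aeval θ₁ a - aeval θ₂ a) * aeval θ₂ b ∈ originIdeal K ^ (n + (D + 1)) := by
        have := Ideal.mul_mem_mul (ApproxCoordChange.aeval_sub_aeval_mem h a) (aeval_mem_pow hθ₂ hb)
        rwa [← pow_add] at this
      have e : aeval θ₁ (a * b) - aeval θ₂ (a * b) =
          aeval θ₁ a * (aeval θ₁ b - aeval θ₂ b) + (aeval θ₁ a - aeval θ₂ a) * aeval θ₂ b := by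
        rw [map_mul, map_mul]; ring
      rw [e]
      exact Ideal.add_mem _ h1 h2
    · have e : aeval θ₁ (x + y) - aeval θ₂ (x + y) =
          (aeval θ₁ x - aeval θ₂ x) + (aeval θ₁ y - aeval θ₂ y) := by
        rw [map_add, map_add]; ring
      rw [e]
      exact Ideal.add_mem _ hx hy

/-- An element of a positive power of `𝔪₀` has no constant term. [folklore] -/
theorem constantCoeff_eq_zero_of_mem_pow {n : ℕ} {r : MvPolynomial (Fin 4) K}
    (hr : r ∈ originIdeal K ^ (n + 1)) : constantCoeff r = 0 :=
  (NarrowApolarity.mem_originIdeal_iff _).mp (Ideal.pow_le_self (Nat.succ_ne_zero n) hr)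

/-! ## §2 Substitutions with tangent map the identity -/

/-- **Left inverse, tangent map `= id`.**  For origin-fixing `w` with `wᵢ − xᵢ ∈ 𝔪₀²` and every `n` there is an
origin-fixing `k` with `k(w(x)) ≡ x mod 𝔪₀^{n+1}`: iterate `k ↦ k − (k∘w − x)`; the error `r = k∘w − x ∈ 𝔪₀^{n+1}`
becomes `r − r∘w ∈ 𝔪₀^{n+2}` by the basic estimate (`w ≡ x mod 𝔪₀²`). [folklore] -/
theorem exists_left_inv_of_tangent_id {w : Fin 4 → MvPolynomial (Fin 4) K}
    (hw0 : ∀ i, constantCoeff (w i) = 0) (hw1 : ∀ i, w i - X i ∈ originIdeal K ^ 2) (n : ℕ) :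
    ∃ k : Fin 4 → MvPolynomial (Fin 4) K, (∀ i, constantCoeff (k i) = 0) ∧
      ∀ i, aeval w (k i) - X i ∈ originIdeal K ^ (n + 1) := by
  induction n with
  | zero =>
    refine ⟨X, fun i => constantCoeff_X (R := K) i, fun i => ?_⟩
    rw [aeval_X, zero_add, pow_one]
    exact Ideal.pow_le_self two_ne_zero (hw1 i)
  | succ n ih =>
    obtain ⟨k, hk0, hk⟩ := ih
    refine ⟨fun i => k i - (aeval w (k i) - X i), fun i => ?_, fun i => ?_⟩
    · rw [map_sub, hk0, constantCoeff_eq_zero_of_mem_pow (hk i), sub_zero]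
    · have hX0 : ∀ i, constantCoeff ((X : Fin 4 → MvPolynomial (Fin 4) K) i) = 0 :=
        fun i => constantCoeff_X (R := K) i
      have hest := aeval_sub_aeval_mem_pow hw0 hX0 (n := 2) hw1 (D := n) (hk i)
      rw [aeval_X_left, AlgHom.id_apply, show 2 + n = n + 1 + 1 by ring] at hest
      have e : aeval w (k i - (aeval w (k i) - X i)) - X i =
          -(aeval w (aeval w (k i) - X i) - (aeval w (k i) - X i)) := by
        rw [map_sub (aeval w) (k i)]; ring
      rw [e]
      exact Submodule.neg_mem _ hest

/-- **Right inverse, tangent map `= id`.**  For `w` with `wᵢ − xᵢ ∈ 𝔪₀²` (so `w` fixes the origin) and every `n` there is an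
origin-fixing `q` with `w(q(x)) ≡ x mod 𝔪₀^{n+1}`: iterate `q ↦ q − (w∘q − x)`; with `h = w − x ∈ 𝔪₀²` the new
error is `h∘q' − h∘q ∈ 𝔪₀^{n+2}` by the basic estimate (`q' ≡ q mod 𝔪₀^{n+1}`). [folklore] -/
theorem exists_right_inv_of_tangent_id {w : Fin 4 → MvPolynomial (Fin 4) K}
    (hw1 : ∀ i, w i - X i ∈ originIdeal K ^ 2) (n : ℕ) :
    ∃ q : Fin 4 → MvPolynomial (Fin 4) K, (∀ i, constantCoeff (q i) = 0) ∧
      ∀ i, aeval q (w i) - X i ∈ originIdeal K ^ (n + 1) := by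
  induction n with
  | zero =>
    refine ⟨X, fun i => constantCoeff_X (R := K) i, fun i => ?_⟩
    rw [aeval_X_left, AlgHom.id_apply, zero_add, pow_one]
    exact Ideal.pow_le_self two_ne_zero (hw1 i)
  | succ n ih =>
    obtain ⟨q, hq0, hq⟩ := ih
    have hq'0 : ∀ i, constantCoeff (q i - (aeval q (w i) - X i)) = 0 := fun i => by
      rw [map_sub, hq0, constantCoeff_eq_zero_of_mem_pow (hq i), sub_zero]
    refine ⟨fun i => q i - (aeval q (w i) - X i), hq'0, fun i => ?_⟩
    have hdiff : ∀ j, (fun i => q i - (aeval q (w i) - X i)) j - q j ∈ originIdeal K ^ (n + 1) := fun j => by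
      show q j - (aeval q (w j) - X j) - q j ∈ _
      rw [sub_sub_cancel_left]
      exact Submodule.neg_mem _ (hq j)
    have hest := aeval_sub_aeval_mem_pow hq'0 hq0 hdiff (D := 1) (hw1 i)
    have e : aeval (fun i => q i - (aeval q (w i) - X i)) (w i) - X i =
        aeval (fun i => q i - (aeval q (w i) - X i)) (w i - X i) - aeval q (w i - X i) := by
      rw [map_sub, map_sub, aeval_X, aeval_X]; ring
    rw [e]
    exact hest

/-- A left inverse and a right inverse modulo `𝔪₀ᴹ` agree modulo `𝔪₀ᴹ`: `u ≡ u∘w∘v ≡ v`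
(`u∘w ≡ x`, `w∘v ≡ x`, `v` origin-fixing). [folklore] -/
theorem sub_mem_of_left_of_right {u v w : Fin 4 → MvPolynomial (Fin 4) K} {M : ℕ}
    (hv : ∀ i, constantCoeff (v i) = 0) (huw : ∀ i, aeval w (u i) - X i ∈ originIdeal K ^ M)
    (hwv : ∀ i, aeval v (w i) - X i ∈ originIdeal K ^ M) (j : Fin 4) : u j - v j ∈ originIdeal K ^ M := by
  have h1 : u j - aeval v (aeval w (u j)) ∈ originIdeal K ^ M := by
    rw [ApproxCoordChange.aeval_aeval]
    have hX : ∀ i, (X : Fin 4 → MvPolynomial (Fin 4) K) i - aeval v (w i) ∈ originIdeal K ^ M :=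
      fun i => by rw [← neg_sub]; exact Submodule.neg_mem _ (hwv i)
    have := ApproxCoordChange.aeval_sub_aeval_mem hX (u j)
    rwa [aeval_X_left, AlgHom.id_apply] at this
  have h2 : aeval v (aeval w (u j)) - v j ∈ originIdeal K ^ M := by
    have := aeval_mem_pow hv (huw j)
    rwa [map_sub, aeval_X] at this
  have e : u j - v j = (u j - aeval v (aeval w (u j))) + (aeval v (aeval w (u j)) - v j) := by ring
  rw [e]
  exact Ideal.add_mem _ h1 h2

/-- … hence a left inverse modulo `𝔪₀ᴹ` is also a right inverse modulo `𝔪₀ᴹ` (given that some right inverse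
exists). [folklore] -/
theorem right_inv_of_left_inv {u v w : Fin 4 → MvPolynomial (Fin 4) K} {M : ℕ}
    (hv : ∀ i, constantCoeff (v i) = 0) (huw : ∀ i, aeval w (u i) - X i ∈ originIdeal K ^ M)
    (hwv : ∀ i, aeval v (w i) - X i ∈ originIdeal K ^ M) (i : Fin 4) :
    aeval u (w i) - X i ∈ originIdeal K ^ M := by
  have e : aeval u (w i) - X i = (aeval u (w i) - aeval v (w i)) + (aeval v (w i) - X i) := by ring
  rw [e]
  exact Ideal.add_mem _
    (ApproxCoordChange.aeval_sub_aeval_mem (fun j => sub_mem_of_left_of_right hv huw hwv j) (w i)) (hwv i)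

/-- **Two-sided inverse, tangent map `= id`**: for origin-fixing `w` with `wᵢ − xᵢ ∈ 𝔪₀²` and every `M` there is an
origin-fixing `k` with `k(w(x)) ≡ x ≡ w(k(x)) mod 𝔪₀ᴹ`. [folklore] -/
theorem exists_inv_of_tangent_id {w : Fin 4 → MvPolynomial (Fin 4) K}
    (hw0 : ∀ i, constantCoeff (w i) = 0) (hw1 : ∀ i, w i - X i ∈ originIdeal K ^ 2) (M : ℕ) :
    ∃ k : Fin 4 → MvPolynomial (Fin 4) K, (∀ i, constantCoeff (k i) = 0) ∧
      (∀ i, aeval w (k i) - X i ∈ originIdeal K ^ M) ∧ (∀ i, aeval k (w i) - X i ∈ originIdeal K ^ M) := by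
  obtain ⟨k, hk0, hk⟩ := exists_left_inv_of_tangent_id hw0 hw1 M
  obtain ⟨q, hq0, hq⟩ := exists_right_inv_of_tangent_id hw1 M
  have hle : originIdeal K ^ (M + 1) ≤ originIdeal K ^ M := Ideal.pow_le_pow_right (Nat.le_succ M)
  exact ⟨k, hk0, fun i => hle (hk i),
    fun i => right_inv_of_left_inv hq0 (fun i => hle (hk i)) (fun i => hle (hq i)) i⟩

/-! ## §3 Linear substitutions and the general case -/

/-- Composition of linear combinations: `A·(B·v) = (AB)·v`. [folklore] -/
theorem sum_C_mul_sum_C_mul (A B : Matrix (Fin 4) (Fin 4) K) (v : Fin 4 → MvPolynomial (Fin 4) K) (i : Fin 4) :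
    ∑ m, C (A i m) * ∑ k, C (B m k) * v k = ∑ k, C ((A * B) i k) * v k := by
  simp only [Matrix.mul_apply, Finset.mul_sum, map_sum, Finset.sum_mul, map_mul]
  rw [Finset.sum_comm]
  exact Finset.sum_congr rfl fun k _ => Finset.sum_congr rfl fun m _ => by ring

/-- `1·v = v`. [folklore] -/
theorem sum_C_one_mul (v : Fin 4 → MvPolynomial (Fin 4) K) (i : Fin 4) :
    ∑ k, C ((1 : Matrix (Fin 4) (Fin 4) K) i k) * v k = v i := by
  simp only [Matrix.one_apply, apply_ite C, map_one, map_zero, ite_mul, one_mul, zero_mul,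
    Finset.sum_ite_eq, Finset.mem_univ, if_true]

/-- The linear coefficients of `A·g` are `A` times those of `g`. [folklore] -/
theorem coeff_single_sum_C_mul (A : Matrix (Fin 4) (Fin 4) K) (g : Fin 4 → MvPolynomial (Fin 4) K)
    (i j : Fin 4) :
    coeff (Finsupp.single j 1) (∑ k, C (A i k) * g k) = ∑ k, A i k * coeff (Finsupp.single j 1) (g k) := by
  simp only [coeff_sum, coeff_C_mul]

/-- **Jet inverse function theorem** (res-dim4-p-7 g3's J1, verbatim).  For an origin-fixing substitution `g` whose
tangent matrix `(∂gᵢ/∂x_k(0))` has unit determinant, and every `M`, there is an origin-fixing `g'` with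
`g'(g(x)) ≡ x mod 𝔪₀ᴹ` and `g(g'(x)) ≡ x mod 𝔪₀ᴹ` (in `aeval` language: `aeval g (g' i) − X i ∈ 𝔪₀ᴹ` and
`aeval g' (g i) − X i ∈ 𝔪₀ᴹ`).  Reduction to tangent map `= id` by `x ↦ L⁻¹x`, then `exists_inv_of_tangent_id`.
[folklore: formal inverse function theorem, truncated] -/
theorem exists_approx_inverse (g : Fin 4 → MvPolynomial (Fin 4) K) (hg : ∀ i, constantCoeff (g i) = 0)
    (hL : IsUnit (Matrix.det (Matrix.of fun i k => coeff (Finsupp.single k 1) (g i)))) (M : ℕ) :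
    ∃ g' : Fin 4 → MvPolynomial (Fin 4) K, (∀ i, constantCoeff (g' i) = 0) ∧
      (∀ i, aeval g (g' i) - X i ∈ originIdeal K ^ M) ∧ (∀ i, aeval g' (g i) - X i ∈ originIdeal K ^ M) := by
  -- the tangent matrix `L`, the linear substitution `lam = L⁻¹·x` and `w = L⁻¹·g` (tangent map `= id`)
  obtain ⟨L, hLdef⟩ : ∃ L : Matrix (Fin 4) (Fin 4) K, L = Matrix.of fun i k => coeff (Finsupp.single k 1) (g i) :=
    ⟨_, rfl⟩
  rw [← hLdef] at hL
  obtain ⟨lam, hlam⟩ : ∃ lam : Fin 4 → MvPolynomial (Fin 4) K, lam = fun i => ∑ k, C (L⁻¹ i k) * X k :=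
    ⟨_, rfl⟩
  obtain ⟨w, hw⟩ : ∃ w : Fin 4 → MvPolynomial (Fin 4) K, w = fun i => ∑ k, C (L⁻¹ i k) * g k := ⟨_, rfl⟩
  have hlam0 : ∀ i, constantCoeff (lam i) = 0 := fun i => by simp [hlam]
  have hw0 : ∀ i, constantCoeff (w i) = 0 := fun i => by simp [hw, hg]
  have hglam : ∀ i, aeval g (lam i) = w i := fun i => by
    simp only [hlam, hw, map_sum, map_mul, aeval_C, algebraMap_eq, aeval_X]
  have hw1 : ∀ i, w i - X i ∈ originIdeal K ^ 2 := by
    intro i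
    rw [IsolationCert.mem_originIdeal_pow_iff]
    intro d hd
    by_cases hd0 : d = 0
    · subst hd0
      rw [← constantCoeff_eq, map_sub, hw0, constantCoeff_X, sub_zero]
    · have hdeg : d.degree = 1 := by
        have : d.degree ≠ 0 := fun h => hd0 ((Finsupp.degree_eq_zero_iff d).mp h)
        omega
      obtain ⟨j, rfl⟩ := IsolationCert.exists_eq_single_of_degree_eq_one hdeg
      have hLL : ∑ k, L⁻¹ i k * coeff (Finsupp.single j 1) (g k) = (L⁻¹ * L) i j := by
        rw [Matrix.mul_apply]
        exact Finset.sum_congr rfl fun k _ => by rw [hLdef, Matrix.of_apply]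
      rw [coeff_sub, hw, coeff_single_sum_C_mul, hLL, Matrix.nonsing_inv_mul L hL, Matrix.one_apply, coeff_X,
        sub_eq_zero]
      by_cases hij : i = j
      · rw [if_pos hij, if_pos (congrArg (Finsupp.single · 1) hij)]
      · rw [if_neg hij, if_neg fun h => hij ((Finsupp.single_left_inj one_ne_zero).mp h)]
  -- two-sided inverse `k` of `w`, and `g' = k ∘ (L⁻¹·x)`
  obtain ⟨k, hk0, hkl, hkr⟩ := exists_inv_of_tangent_id hw0 hw1 M
  refine ⟨fun i => aeval lam (k i), fun i => ?_, fun i => ?_, fun i => ?_⟩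
  · rw [CoordChange.constantCoeff_aeval_of_origin lam hlam0]
    exact hk0 i
  · rw [ApproxCoordChange.aeval_aeval, show (fun j => aeval g (lam j)) = w from funext hglam]
    exact hkl i
  · rw [← ApproxCoordChange.aeval_aeval]
    -- `g = L·w`, so `k(g) = L·x + L·(k(w) − x)` and `lam(L·x) = x`
    have hgi : g i = ∑ m, C (L i m) * w m := by
      rw [hw]
      simp only
      rw [sum_C_mul_sum_C_mul, Matrix.mul_nonsing_inv L hL, sum_C_one_mul]
    have e : aeval k (g i) = ∑ m, C (L i m) * X m + ∑ m, C (L i m) * (aeval k (w m) - X m) := by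
      rw [hgi, map_sum, ← Finset.sum_add_distrib]
      refine Finset.sum_congr rfl fun m _ => ?_
      rw [map_mul, aeval_C, algebraMap_eq]
      ring
    have h1 : aeval lam (∑ m, C (L i m) * X m) = X i := by
      simp only [map_sum, map_mul, aeval_C, algebraMap_eq, aeval_X]
      rw [hlam]
      simp only
      rw [sum_C_mul_sum_C_mul, Matrix.mul_nonsing_inv L hL, sum_C_one_mul]
    rw [e, map_add, h1, add_sub_cancel_left]
    exact aeval_mem_pow hlam0 (Ideal.sum_mem _ fun m _ => Ideal.mul_mem_left _ _ (hkr m))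

end JetInverse

end Summit.ResolutionOfSingularities.ResolutionOfSingularities.Theorems.PIDim4

end
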